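import Literature.Geometry.Symplectic.SteinHandleProfileAssembly
import HarnessLib

/-!
# Assembling Eliashberg's handle profile, II: the region identities and the quadric tail

Topic `Literature/Geometry/Symplectic`; proofs file of the fact seat of
`Literature.Geometry.Symplectic.Gompf1998_thm13_twoHandles` (**E2**, `SteinTwoHandles.lean`),
sequel of `SteinHandleProfileAssembly.lean` (the glued second derivative `φ ω β`, the slope
`fp ω β = startSlope(t_L) + ∫_{t_L} φ` and the profile `ff ω β r₀ = startFn r₀ (t_L) + ∫_{t_L} fp`
of the `C^∞` variant of Forstnerič–Kozak's profile, Prop. 3.1 = Eliashberg 1990,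
Lemma 3.4.3).  Here:

* §1 `φ`, `fp`, `ff` are affine in the correction parameter `β` and in `r₀`
  (`φ_eq_add_mul_ψ`, `fp_eq_add_mul`, `ff_add_r₀`); the bump integral `Iψ ω = ∫_{t_L}^{ε(1+ω)} ψ`
  is positive (`Iψ_pos`);
* §2 **the region identities** (FTC): on the descending region `t₂(1+ω) ≤ t ≤ η(1-ω)` the
  slope is the descending law up to a constant, `fp ω β t = descSlope C η t + δ₁`
  (`fp_eq_descSlope_add`); on the convex region `η(1+ω) ≤ t ≤ ε(1-ω)` one has `φ = Q₁ + βψ`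
  (`φ_eq_Q₁_add`); on the tail `t ≥ T = ε(1+ω)` one has `φ = Q_g = g''` (`φ_eq_Qg`);
* §3 **the tail**: with `β⋆ ω = (g'(T) - fp ω 0 T)/Iψ ω` and `r₀⋆ ω = g(T) - ff ω β⋆ 0 T`
  (Forstnerič–Kozak (i): *"`f(t) = g(t)` for `t ≥ ε`"*) the slope and the profile **agree with
  the quadric** `g = √(λt² + 1)` for `t ≥ T`: `fp ω β⋆ t = g'(t)`, `ff ω β⋆ r₀⋆ t = g(t)`
  (`fp_eq_quadric_deriv`, `ff_eq_quadric`).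

Everything is **proved**; three definitions (`Iψ`, `βs`, `r₀s`), no named fact.

## References

* F. Forstnerič, J. Kozak, *Strongly pseudoconvex handlebodies*, J. Korean Math. Soc. 40
  (2003), 727–745 (arXiv:math/0305237), Prop. 3.1 (i) and its proof. [ForstnericKozak2003]
* Ya. Eliashberg, *Topological characterization of Stein manifolds of dimension > 2*,
  Internat. J. Math. 1 (1990), 29–46, Lemma 3.4.3. [Eliashberg1990Stein]
-/

noncomputable section

open Set Filter MeasureTheory intervalIntegral
open scoped Topology ContDiff

namespace Literature.Geometry.Symplectic

namespace HParam

variable {P : HParam}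

/-! ### §1 Affinity in `β` and `r₀`; the bump integral -/

/-- `φ ω β = φ ω 0 + β ψ`. [folklore] -/
theorem φ_eq_add_mul_ψ (om β t : ℝ) : P.φ om β t = P.φ om 0 t + β * P.ψ t := by
  simp only [φ]; ring

/-- `ψ ≥ 0`. [folklore] -/
theorem ψ_nonneg (t : ℝ) : 0 ≤ P.ψ t := by
  rw [ψ]
  exact mul_nonneg (window_nonneg t) (by linarith [@window_le_one (P.ε / 2) (1 / 10) t])

/-- `ψ ≤ 1`. [folklore] -/
theorem ψ_le_one (t : ℝ) : P.ψ t ≤ 1 := by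
  rw [ψ]
  have h1 := @window_le_one (P.ε / 3) (1 / 10) t
  have h2 := @window_nonneg (P.ε / 2) (1 / 10) t
  have h3 := @window_nonneg (P.ε / 3) (1 / 10) t
  nlinarith

/-- `ψ = 1` on `[11ε/30, 9ε/20]`. [folklore] -/
theorem ψ_eq_one (h : P.Pos) {t : ℝ} (h1 : 11 * P.ε / 30 ≤ t) (h2 : t ≤ 9 * P.ε / 20) : P.ψ t = 1 := by
  have hε := h.ε_pos
  rw [ψ, window_one_of_ge (by positivity) (by norm_num) (by linarith),
    window_zero_of_le (by positivity) (by norm_num) (by linarith)]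
  ring

/-- `ψ = 0` on `t ≥ 11ε/20`. [folklore] -/
theorem ψ_zero_of_ge (h : P.Pos) {t : ℝ} (ht : 11 * P.ε / 20 ≤ t) : P.ψ t = 0 := by
  have hε := h.ε_pos
  rw [ψ, @window_one_of_ge (P.ε / 2) (1 / 10) (by positivity) (by norm_num) t (by linarith)]
  ring

/-- **`f'` is affine in `β`**: `fp ω β t = fp ω 0 t + β ∫_{t_L}^t ψ` (`t > σ`, `0 < ω ≤ 1/8`).
[folklore] -/
theorem fp_eq_add_mul (h : P.Pos) {om : ℝ} (hom : 0 < om) (hom8 : om ≤ 1 / 8) (β : ℝ) {t : ℝ}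
    (ht : P.σ < t) : P.fp om β t = P.fp om 0 t + β * ∫ x in P.tL..t, P.ψ x := by
  have hsub : uIcc P.tL t ⊆ Ioi P.σ := fun x hx => by
    rcases le_total P.tL t with h1 | h1
    · rw [uIcc_of_le h1] at hx; exact lt_of_lt_of_le h.σ_lt_tL hx.1
    · rw [uIcc_of_ge h1] at hx; exact lt_of_lt_of_le ht hx.1
  have hi0 : IntervalIntegrable (P.φ om 0) volume P.tL t :=
    ((contDiffOn_phi h hom hom8 0 (n := ⊤)).continuousOn.mono hsub).intervalIntegrable
  have hψc : Continuous P.ψ := (contDiff_ψ (n := ⊤)).continuous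
  have hiψ : IntervalIntegrable (fun x => β * P.ψ x) volume P.tL t :=
    (continuous_const.mul hψc).intervalIntegrable _ _
  have hcongr : ∫ x in P.tL..t, P.φ om β x = ∫ x in P.tL..t, (P.φ om 0 x + β * P.ψ x) :=
    integral_congr fun x _ => φ_eq_add_mul_ψ om β x
  rw [fp, fp, hcongr, integral_add hi0 hiψ, intervalIntegral.integral_const_mul]
  ring

/-- **`f` is affine in `r₀`**: `ff ω β r₀ t = ff ω β 0 t + r₀`. [folklore] -/
theorem ff_add_r₀ (om β r₀ t : ℝ) : P.ff om β r₀ t = P.ff om β 0 t + r₀ := by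
  simp only [ff, startFn]; ring

/-- **The bump integral** `Iψ ω = ∫_{t_L}^{ε(1+ω)} ψ`. [folklore] -/
def Iψ (P : HParam) (om : ℝ) : ℝ := ∫ x in P.tL..(P.ε * (1 + om)), P.ψ x

/-- `Iψ ω ≥ ε/12 > 0` (`0 < ω`): `ψ = 1` on `[11ε/30, 9ε/20]` and `ψ ≥ 0`. [folklore] -/
theorem Iψ_pos (h : P.Pos) {om : ℝ} (hom : 0 < om) : P.ε / 12 ≤ P.Iψ om := by
  have hε := h.ε_pos
  have hσε := h.σ_lt_ε
  have htL : P.tL ≤ 11 * P.ε / 30 := by rw [tL_eq]; linarith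
  have hT : 9 * P.ε / 20 ≤ P.ε * (1 + om) := by nlinarith
  have hψi : ∀ a b, IntervalIntegrable P.ψ volume a b := fun a b =>
    (contDiff_ψ (n := ⊤)).continuous.intervalIntegrable a b
  -- split the integral
  have hsplit : P.Iψ om = (∫ x in P.tL..(11 * P.ε / 30), P.ψ x) +
      ((∫ x in (11 * P.ε / 30)..(9 * P.ε / 20), P.ψ x) + ∫ x in (9 * P.ε / 20)..(P.ε * (1 + om)), P.ψ x) := by
    rw [Iψ, integral_add_adjacent_intervals (hψi _ _) (hψi _ _),
      integral_add_adjacent_intervals (hψi _ _) (hψi _ _)]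
  have h1 : 0 ≤ ∫ x in P.tL..(11 * P.ε / 30), P.ψ x :=
    integral_nonneg htL fun x _ => ψ_nonneg x
  have h3 : 0 ≤ ∫ x in (9 * P.ε / 20)..(P.ε * (1 + om)), P.ψ x :=
    integral_nonneg hT fun x _ => ψ_nonneg x
  have h2 : ∫ x in (11 * P.ε / 30)..(9 * P.ε / 20), P.ψ x = 9 * P.ε / 20 - 11 * P.ε / 30 := by
    rw [integral_congr (g := fun _ => (1 : ℝ)) fun x hx => ?_, intervalIntegral.integral_const, smul_eq_mul, mul_one]
    rw [uIcc_of_le (by linarith)] at hx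
    exact ψ_eq_one h hx.1 hx.2
  rw [hsplit, h2]
  linarith

/-! ### §2 The region identities -/

/-- Sizes of the constants used below: `t₂(1 + ω) < η(1 - ω)` and `η(1 + ω) < 3ε/10`
(`ω ≤ 1/8`, from `t₂ ≤ η e^{-3/4} ≤ η/2` and `η < ε/4`). [folklore] -/
theorem Pos.t₂_lt_half_η (h : P.Pos) : P.t₂ ≤ P.η / 2 := by
  rw [t₂]
  have h1 : Real.exp (-(P.Cc - 1 / 4)) ≤ 1 / 2 := by
    have h2 : -(P.Cc - 1 / 4) ≤ -(3 / 4) := by linarith [h.one_le_Cc]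
    have h3 : Real.exp (-(3 / 4 : ℝ)) ≤ 1 / 2 := by
      -- `e^{3/4} ≥ 1 + 3/4 + (3/4)²/2 > 2`
      have h4 : (2 : ℝ) ≤ Real.exp (3 / 4) := by
        have := Real.quadratic_le_exp_of_nonneg (by norm_num : (0:ℝ) ≤ 3 / 4)
        linarith
      rw [Real.exp_neg, inv_le_comm₀ (Real.exp_pos _) (by norm_num)]
      linarith
    exact (Real.exp_le_exp.2 h2).trans h3
  nlinarith [h.η_pos]

/-- **On the descending region `φ = Q₂`** (`t₂(1+ω) ≤ t ≤ η(1-ω)`, `0 < ω`). [cite: ForstnericKozak2003, Prop. 3.1] -/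
theorem φ_eq_Q₂ (h : P.Pos) {om : ℝ} (hom : 0 < om) (β : ℝ) {t : ℝ} (h1 : P.t₂ * (1 + om) ≤ t)
    (h2 : t ≤ P.η * (1 - om)) : P.φ om β t = P.Q₂ t := by
  have hw1 : window P.t₂ om t = 1 := window_one_of_ge h.t₂_pos hom h1
  have hw2 : window P.η om t = 0 := window_zero_of_le h.η_pos hom h2
  have hψ : P.ψ t = 0 := by
    apply ψ_zero_of_le h
    have : P.η * (1 - om) ≤ P.η := by nlinarith [h.η_pos]
    linarith [h.η_lt, h.ε_pos]
  rw [φ, hw1, hw2, hψ]; ring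

/-- **On the convex region `φ = Q₁ + βψ`** (`η(1+ω) ≤ t ≤ ε(1-ω)`, `0 < ω`). [cite: ForstnericKozak2003, Prop. 3.1] -/
theorem φ_eq_Q₁_add (h : P.Pos) {om : ℝ} (hom : 0 < om) (β : ℝ) {t : ℝ} (h1 : P.η * (1 + om) ≤ t)
    (h2 : t ≤ P.ε * (1 - om)) : P.φ om β t = P.Q₁ t + β * P.ψ t := by
  have h0 : P.t₂ * (1 + om) ≤ t := by
    have := h.t₂_lt_half_η; nlinarith [h.η_pos]
  have hw1 : window P.t₂ om t = 1 := window_one_of_ge h.t₂_pos hom h0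
  have hw2 : window P.η om t = 1 := window_one_of_ge h.η_pos hom h1
  have hw3 : window P.ε om t = 0 := window_zero_of_le h.ε_pos hom h2
  rw [φ, hw1, hw2, hw3]; ring

/-- **On the tail `φ = Q_g`** (`t ≥ ε(1+ω)`, `0 < ω`). [cite: ForstnericKozak2003, Prop. 3.1] -/
theorem φ_eq_Qg (h : P.Pos) {om : ℝ} (hom : 0 < om) (β : ℝ) {t : ℝ} (ht : P.ε * (1 + om) ≤ t) :
    P.φ om β t = P.Qg t := by
  have hε := h.ε_pos
  have h2 : P.η * (1 + om) ≤ t := by nlinarith [h.η_lt, h.η_pos]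
  have h1 : P.t₂ * (1 + om) ≤ t := by have := h.t₂_lt_half_η; nlinarith [h.η_pos]
  have hw1 : window P.t₂ om t = 1 := window_one_of_ge h.t₂_pos hom h1
  have hw2 : window P.η om t = 1 := window_one_of_ge h.η_pos hom h2
  have hw3 : window P.ε om t = 1 := window_one_of_ge hε hom ht
  have hψ : P.ψ t = 0 := ψ_zero_of_ge h (by nlinarith)
  rw [φ, hw1, hw2, hw3, hψ]; ring

/-- **The slope on the descending region is the descending law up to a constant**:
`fp ω β t - descSlope C η t` is the same for all `t₂(1+ω) ≤ t ≤ η(1-ω)`.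
[cite: ForstnericKozak2003, Prop. 3.1] -/
theorem fp_sub_descSlope_eq (h : P.Pos) {om : ℝ} (hom : 0 < om) (hom8 : om ≤ 1 / 8) (β : ℝ)
    {t t' : ℝ} (h1 : P.t₂ * (1 + om) ≤ t) (h2 : t ≤ P.η * (1 - om))
    (h1' : P.t₂ * (1 + om) ≤ t') (h2' : t' ≤ P.η * (1 - om)) :
    P.fp om β t - descSlope P.Cc P.η t = P.fp om β t' - descSlope P.Cc P.η t' := by
  have hσ := h.σ_pos
  have ht₂ := t₂_eq P
  have hlo : ∀ x ∈ uIcc t' t, P.t₂ * (1 + om) ≤ x ∧ x ≤ P.η * (1 - om) := fun x hx => by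
    rcases le_total t' t with hle | hle
    · rw [uIcc_of_le hle] at hx; exact ⟨h1'.trans hx.1, hx.2.trans h2⟩
    · rw [uIcc_of_ge hle] at hx; exact ⟨h1.trans hx.1, hx.2.trans h2'⟩
  have h85 : ∀ x ∈ uIcc t' t, 8 * P.σ / 5 < x := fun x hx => by
    have := (hlo x hx).1; rw [ht₂] at this; nlinarith
  have hσx : ∀ x ∈ uIcc t' t, P.σ < x := fun x hx => by linarith [h85 x hx]
  -- `fp t - fp t' = ∫_{t'}^t φ = ∫_{t'}^t Q₂ = descSlope t - descSlope t'`
  have hderiv : ∀ x ∈ uIcc t' t, HasDerivAt (P.fp om β) (P.φ om β x) x := fun x hx =>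
    hasDerivAt_fp h hom hom8 β (hσx x hx)
  have hint : IntervalIntegrable (P.φ om β) volume t' t :=
    ((contDiffOn_phi h hom hom8 β (n := ⊤)).continuousOn.mono fun x hx => hσx x hx).intervalIntegrable
  have hI := integral_eq_sub_of_hasDerivAt hderiv hint
  have hderiv2 : ∀ x ∈ uIcc t' t, HasDerivAt (descSlope P.Cc P.η) (P.Q₂ x) x := fun x hx =>
    hasDerivAt_descSlope h.η_pos (by linarith [h85 x hx]) (descDomain h (h85 x hx))
  have hint2 : IntervalIntegrable P.Q₂ volume t' t :=
    ((contDiffOn_Q₂ h (n := ⊤)).continuousOn.mono fun x hx => h85 x hx).intervalIntegrable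
  have hI2 := integral_eq_sub_of_hasDerivAt hderiv2 hint2
  have hcongr : ∫ x in t'..t, P.φ om β x = ∫ x in t'..t, P.Q₂ x :=
    integral_congr fun x hx => φ_eq_Q₂ h hom β (hlo x hx).1 (hlo x hx).2
  rw [hcongr, hI2] at hI
  linarith

/-! ### §3 The tail: choice of `β` and `r₀`, agreement with the quadric -/

/-- **The correction parameter** `β⋆ = (g'(T) - fp ω 0 T)/Iψ`, `T = ε(1 + ω)`, making
`f'(T) = g'(T)`. [cite: ForstnericKozak2003, Prop. 3.1] -/
def βs (P : HParam) (om : ℝ) : ℝ :=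
  (P.l * (P.ε * (1 + om)) / quadric P.l (P.ε * (1 + om)) - P.fp om 0 (P.ε * (1 + om))) / P.Iψ om

/-- **The constant** `r₀⋆ = g(T) - ff ω β⋆ 0 T`, making `f(T) = g(T)`; it is the limit
`f(σ+)`, the height at which the tube `{|x| = σ}` ends. [cite: ForstnericKozak2003, Prop. 3.1] -/
def r₀s (P : HParam) (om : ℝ) : ℝ :=
  quadric P.l (P.ε * (1 + om)) - P.ff om (P.βs om) 0 (P.ε * (1 + om))

/-- `f'(T) = g'(T)` for `β = β⋆`. [folklore] -/
theorem fp_T (h : P.Pos) {om : ℝ} (hom : 0 < om) (hom8 : om ≤ 1 / 8) :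
    P.fp om (P.βs om) (P.ε * (1 + om)) = P.l * (P.ε * (1 + om)) / quadric P.l (P.ε * (1 + om)) := by
  have hT : P.σ < P.ε * (1 + om) := by nlinarith [h.σ_lt_ε, h.ε_pos, h.σ_pos]
  have hI : 0 < P.Iψ om := lt_of_lt_of_le (by linarith [h.ε_pos]) (Iψ_pos h hom)
  rw [fp_eq_add_mul h hom hom8 _ hT, βs]
  rw [show (∫ x in P.tL..(P.ε * (1 + om)), P.ψ x) = P.Iψ om from rfl]
  field_simp
  ring

/-- `f(T) = g(T)` for `β = β⋆`, `r₀ = r₀⋆`. [folklore] -/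
theorem ff_T (om : ℝ) :
    P.ff om (P.βs om) (P.r₀s om) (P.ε * (1 + om)) = quadric P.l (P.ε * (1 + om)) := by
  rw [ff_add_r₀, r₀s]; ring

/-- **The slope agrees with `g'` on the tail**: `fp ω β⋆ t = λt/g(t)` for `t ≥ ε(1 + ω)`
(both have derivative `g''` there and agree at `T`). [cite: ForstnericKozak2003, Prop. 3.1] -/
theorem fp_eq_quadric_deriv (h : P.Pos) {om : ℝ} (hom : 0 < om) (hom8 : om ≤ 1 / 8) {t : ℝ}
    (ht : P.ε * (1 + om) ≤ t) : P.fp om (P.βs om) t = P.l * t / quadric P.l t := by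
  set T := P.ε * (1 + om) with hTdef
  have hσT : P.σ < T := by rw [hTdef]; nlinarith [h.σ_lt_ε, h.ε_pos, h.σ_pos]
  have hl := h.l_nonneg
  have hmem : ∀ x ∈ uIcc T t, T ≤ x := fun x hx => by rw [uIcc_of_le ht] at hx; exact hx.1
  have hderiv : ∀ x ∈ uIcc T t, HasDerivAt (fun y => P.fp om (P.βs om) y - P.l * y / quadric P.l y) 0 x := by
    intro x hx
    have hx := hmem x hx
    have h1 := hasDerivAt_fp h hom hom8 (P.βs om) (lt_of_lt_of_le hσT hx)
    have h2 := hasDerivAt_deriv_quadric hl x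
    have h3 := h1.sub h2
    rw [φ_eq_Qg h hom _ hx, Qg, sub_self] at h3
    exact h3
  have hI := integral_eq_sub_of_hasDerivAt hderiv (by simp)
  norm_num at hI
  have h0 : P.fp om (P.βs om) T - P.l * T / quadric P.l T = 0 := by rw [fp_T h hom hom8, sub_self]
  linarith

/-- **The profile agrees with `g` on the tail**: `ff ω β⋆ r₀⋆ t = √(λt² + 1)` for
`t ≥ ε(1 + ω)` — Forstnerič–Kozak (i), *"`f(t) = g(t)` for `t ≥ ε`"*, here from `ε(1 + ω)`.
[cite: ForstnericKozak2003, Prop. 3.1] -/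
theorem ff_eq_quadric (h : P.Pos) {om : ℝ} (hom : 0 < om) (hom8 : om ≤ 1 / 8) {t : ℝ}
    (ht : P.ε * (1 + om) ≤ t) : P.ff om (P.βs om) (P.r₀s om) t = quadric P.l t := by
  set T := P.ε * (1 + om) with hTdef
  have hσT : P.σ < T := by rw [hTdef]; nlinarith [h.σ_lt_ε, h.ε_pos, h.σ_pos]
  have hl := h.l_nonneg
  have hmem : ∀ x ∈ uIcc T t, T ≤ x := fun x hx => by rw [uIcc_of_le ht] at hx; exact hx.1
  have hderiv : ∀ x ∈ uIcc T t,
      HasDerivAt (fun y => P.ff om (P.βs om) (P.r₀s om) y - quadric P.l y) 0 x := by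
    intro x hx
    have hx := hmem x hx
    have h1 := hasDerivAt_ff h hom hom8 (P.βs om) (P.r₀s om) (lt_of_lt_of_le hσT hx)
    have h2 := hasDerivAt_quadric hl x
    have h3 := h1.sub h2
    rw [fp_eq_quadric_deriv h hom hom8 hx, sub_self] at h3
    exact h3
  have hI := integral_eq_sub_of_hasDerivAt hderiv (by simp)
  norm_num at hI
  have h0 : P.ff om (P.βs om) (P.r₀s om) T - quadric P.l T = 0 := by rw [ff_T, sub_self]
  linarith

end HParam

end Literature.Geometry.Symplectic

end
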